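import Mathlib
import Literature.AlgebraicGeometry.Tropical.TorusCycles
import Summits.HodgeConjecture.HodgeConjecture.Theorems.TropicalWeilObstructionTropicalWeilVanishingTransportPhase
import Summits.HodgeConjecture.HodgeConjecture.Theorems.TropicalWeilObstructionTropicalWeilVanishingTransportSeed
import Summits.HodgeConjecture.HodgeConjecture.Theorems.TropicalWeilObstructionTropicalWeilVanishingGenericDense
import Summits.HodgeConjecture.HodgeConjecture.Theorems.TropicalWeilObstructionTropicalWeilVanishingGenericSpread
import Summits.HodgeConjecture.HodgeConjecture.Theorems.TropicalWeilObstructionTropicalHodgeBoundHermitianPairing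
import Summits.HodgeConjecture.HodgeConjecture.Theorems.TropicalWeilObstructionTropicalWeilVanishingBoundaryCalibrated
import Summits.HodgeConjecture.HodgeConjecture.Theorems.TropicalWeilObstructionTropicalWeilVanishingBoundaryVanishing
import Summits.HodgeConjecture.HodgeConjecture.Theorems.TropicalWeilObstructionTropicalWeilVanishingIntegralityLattice
import Summits.HodgeConjecture.HodgeConjecture.Theorems.TropicalWeilObstructionTropicalWeilVanishingCalibrationTwoBoundary
import HarnessLib

/-!
# Crux `TropicalWeilVanishing` (stmt-HodgeConjecture-18478) — the boundary sub-question K1_∂ has no preferred phase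

Route `TropicalWeilObstruction` of `HodgeConjecture` (Hodge NEGATION SINK `pub-hodge-tropical`; scoped exploration,
no summit claim; nothing here bears on the Hodge conjecture; nothing here decides K1 or K1_∂).

K1_∂ (`Boundary.TropicalWeilBoundaryVanishing`, p349747): at a very general tropical Weil eightfold period every
CALIBRATED effective tropical `4`-cycle (`‖W(Z)‖ = μ(Z)`) has `W(Z) = 0`. The class of a calibrated cycle is an integer
lattice point `(a, b, c)` of the cone BOUNDARY `64(b² + c²) = a²` (p345948, p348404); its phase `W/μ = 8(b − ic)/a`
is a RATIONAL point of the unit circle. This file normalises the phase away: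

* `headDiag_*` — the integral `ℤ[i]`-linear map `F = diag_ℂ(α + βi, 1, 1, 1)` on `ℤ⁸ = ℤ[i]⁴`: commutes with `J`,
  `det F ≠ 0`, `det_ℂ F = α + βi`;
* `tropicalWeilBoundaryVanishing_iff_phase` — **K1_∂ ⟺ every effective tropical 4-cycle with `W(Z) = −μ(Z)` at a
  very general period has `W(Z) = 0`**: a calibrated counterexample of class `(a, b, c)` is transported along
  `diag_ℂ(d, 1, 1, 1)`, `d = −8c + (a + 8b)i` (`d·(b − ic) = −(a/8)·conj d`), to an unobstructed seed on `F Q Fᵀ`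
  (`…TransportSeed.exists_transport_seed`, fed by `genericSpread`) of phase `−1`, realised with the same phase at a
  Weil-generic period nearby (`exists_weilGeneric_calibrated_of_collinear_unobstructedSeed`, p358045, with the
  density `…GenericDense.exists_weilGeneric_mem_of_open_of_posDef` as its accumulation hypothesis);
* `tropicalWeilBoundaryVanishing_iff_re_eq_zero` — **K1_∂ ⟺ at a very general period every effective tropical
  4-cycle all of whose cells have PURELY IMAGINARY complex determinant (`Re η_σ = 0`) is EMPTY** — the verbatim
  `n = 4` analogue of the property `CalibTwo.reEta_Fz_eq_zero` that the tree's unobstructed `n = 2` seed has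
  (p358045: at `n = 2` such cycles exist at very general periods, so the `n = 2` analogue of K1_∂ is false).

Phase rule behind it (the cell's REFEREE-K1K2 R-P1): scalar isogenies `k = a + bJ` act on phases by `(k/k̄)ⁿ` on the
same torus (`…TransportPhase.exists_endomorphism_transport`); non-scalar rational `ℤ[i]`-linear maps act by
`det_ℂ/conj det_ℂ` — every rational point of the circle — between congruent periods, and congruent periods are
again accumulation points of Weil-generic ones. Mathlib + tree lemmas; no definition, no named fact, no sorry.

## References

* [Zharkov2020TropicalWeil] I. Zharkov, Tropical abelian varieties, Weil classes and the Hodge conjecture,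
  arXiv:2002.02347 (2020), §2 (pp. 2–4).
* [MikhalkinZharkov2014Eigenwave] G. Mikhalkin, I. Zharkov, Tropical eigenwave and intermediate Jacobians,
  LN UMI 15 (2014), Def. 4.2, Prop. 4.3, Thm. 5.4, Def. 6.1.
-/

-- `Summit.HodgeConjecture.HodgeConjecture.…` is the mandated namespace (single-conjunct summit).
set_option linter.dupNamespace false

noncomputable section

open scoped BigOperators Matrix ComplexConjugate Topology
open Filter Matrix Literature.AlgebraicGeometry.Tropical

namespace Summit.HodgeConjecture.HodgeConjecture.Theorems.TropicalWeilVanishing.Phases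

/-! ## §0 Display-only notation (verbatim bodies of the K3 / Boundary / TransportPhase files; nothing is defined) -/

/-- `P = [1 | i·1]`. -/
local notation3 (prettyPrint := false) "𝐏⟦" n "⟧" =>
  (Matrix.of fun (k : Fin n) (a : Fin (2 * n)) =>
    (if (a : ℕ) = (k : ℕ) then (1 : ℂ) else 0) + (if (a : ℕ) = (k : ℕ) + n then Complex.I else 0))

/-- The hermitian mass `μ(Z)` (display-only). -/
local notation3 (prettyPrint := false) "μ⟦" n ", " Z "⟧" =>
  (∑ σ, ((TropicalTorusCycle.cell Z σ).weight : ℝ) * (TropicalTorusCycle.cell Z σ).latticeVolume *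
    ‖frameComplexDet n (TropicalTorusCycle.cell Z σ).frame‖ ^ 2)

/-- `det_ℂ(F)` (display-only; as in `…TransportPhase`). -/
local notation3 (prettyPrint := false) "detC⟦" n ", " F "⟧" =>
  (Matrix.det (Matrix.of fun k j : Fin n =>
    ((F ⟨(k : ℕ), Nat.lt_of_lt_of_le k.isLt (Nat.le_mul_of_pos_left n Nat.two_pos)⟩
        ⟨(j : ℕ), Nat.lt_of_lt_of_le j.isLt (Nat.le_mul_of_pos_left n Nat.two_pos)⟩ : ℤ) : ℂ) +
      ((F ⟨(k : ℕ) + n, Nat.lt_of_lt_of_eq (Nat.add_lt_add_right k.isLt n) (two_mul n).symm⟩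
        ⟨(j : ℕ), Nat.lt_of_lt_of_le j.isLt (Nat.le_mul_of_pos_left n Nat.two_pos)⟩ : ℤ) : ℂ) * Complex.I))

/-- The integral `ℤ[i]`-linear map `diag_ℂ(α + βi, 1, 1, 1)` on `ℤ⁸ = ℤ[i]⁴` (`z₀ ↦ (α + βi) z₀`, `z_k ↦ z_k` for
`k ≥ 1`; coordinates `z_k = x_k + i x_{k+4}`) as an `8 × 8` integer matrix (display-only expression). -/
local notation3 (prettyPrint := false) "𝐅⟦" α ", " β "⟧" =>
  (Matrix.of fun x y : Fin (2 * 4) =>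
    (if x = y then (if (x : ℕ) = 0 ∨ (x : ℕ) = 4 then (α : ℤ) else 1) else 0) +
      (if (x : ℕ) = 0 ∧ (y : ℕ) = 4 then -(β : ℤ) else 0) + (if (x : ℕ) = 4 ∧ (y : ℕ) = 0 then (β : ℤ) else 0))

/-! ## §1 The phase-fixing transport `diag_ℂ(α + βi, 1, 1, 1)` -/

/-- `𝐅⟦α, β⟧` commutes with `J = weilJ 4`. [folklore] -/
theorem headDiag_comm (α β : ℤ) :
    (𝐅⟦α, β⟧).map ((↑) : ℤ → ℝ) * weilJ 4 = weilJ 4 * (𝐅⟦α, β⟧).map ((↑) : ℤ → ℝ) := by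
  ext x y
  fin_cases x <;> fin_cases y <;>
    simp [Matrix.mul_apply, Fin.sum_univ_eight, weilJ, Matrix.map_apply, Matrix.of_apply]

/-- `𝐅⟦α, β⟧ · 𝐅⟦α, −β⟧ = diag(α² + β², 1, 1, 1, α² + β², 1, 1, 1)`. [folklore] -/
theorem headDiag_mul_conj (α β : ℤ) :
    𝐅⟦α, β⟧ * 𝐅⟦α, -β⟧ =
      Matrix.diagonal fun x : Fin (2 * 4) => if (x : ℕ) = 0 ∨ (x : ℕ) = 4 then α ^ 2 + β ^ 2 else 1 := by
  ext x y
  fin_cases x <;> fin_cases y <;>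
    simp [Matrix.mul_apply, Fin.sum_univ_eight, Matrix.of_apply] <;> ring

/-- `det 𝐅⟦α, β⟧ ≠ 0` for `(α, β) ≠ (0, 0)`. [folklore] -/
theorem headDiag_det_ne_zero (α β : ℤ) (h : α ≠ 0 ∨ β ≠ 0) : (𝐅⟦α, β⟧).det ≠ 0 := by
  intro h0
  have := congrArg Matrix.det (headDiag_mul_conj α β)
  rw [Matrix.det_mul, h0, zero_mul, Matrix.det_diagonal] at this
  have hpos : (0 : ℤ) < ∏ x : Fin (2 * 4), (if (x : ℕ) = 0 ∨ (x : ℕ) = 4 then α ^ 2 + β ^ 2 else 1) := by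
    apply Finset.prod_pos
    intro x _
    split_ifs
    · rcases h with ha | hb
      · have : 0 < α ^ 2 := by positivity
        positivity
      · have : 0 < β ^ 2 := by positivity
        positivity
    · exact one_pos
  exact absurd this hpos.ne

/-- `det_ℂ 𝐅⟦α, β⟧ = α + βi`. [folklore] -/
theorem headDiag_detC (α β : ℤ) : detC⟦4, 𝐅⟦α, β⟧⟧ = (α : ℂ) + (β : ℂ) * Complex.I := by
  have : (Matrix.of fun k j : Fin 4 =>
      (((𝐅⟦α, β⟧) ⟨(k : ℕ), Nat.lt_of_lt_of_le k.isLt (Nat.le_mul_of_pos_left 4 Nat.two_pos)⟩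
          ⟨(j : ℕ), Nat.lt_of_lt_of_le j.isLt (Nat.le_mul_of_pos_left 4 Nat.two_pos)⟩ : ℤ) : ℂ) +
        (((𝐅⟦α, β⟧) ⟨(k : ℕ) + 4, Nat.lt_of_lt_of_eq (Nat.add_lt_add_right k.isLt 4) (two_mul 4).symm⟩
          ⟨(j : ℕ), Nat.lt_of_lt_of_le j.isLt (Nat.le_mul_of_pos_left 4 Nat.two_pos)⟩ : ℤ) : ℂ) * Complex.I) =
      Matrix.diagonal ![(α : ℂ) + (β : ℂ) * Complex.I, 1, 1, 1] := by
    ext k j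
    fin_cases k <;> fin_cases j <;> simp [Matrix.of_apply]
  rw [this, Matrix.det_diagonal, Fin.prod_univ_four]
  simp

/-! ## §2 The boundary sub-question K1_∂ has no preferred phase -/

/-- `0 ≤ a + 8b` for an integer lattice point `(a, b, c)` of the cone boundary `64(b² + c²) = a²`, `0 ≤ a`, with
equality only at the phase-`(−1)` point `(a, b, c) = (a, −a/8, 0)`. [folklore] -/
theorem add_eight_mul_pos_of_boundary {a b c : ℤ} (hbd : 64 * (b ^ 2 + c ^ 2) = a ^ 2) (ha : 0 ≤ a)
    (hne : ¬(c = 0 ∧ a + 8 * b = 0)) : 0 < a + 8 * b := by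
  have h1 : (8 * b) ^ 2 ≤ a ^ 2 := by nlinarith [sq_nonneg c]
  obtain ⟨h2, -⟩ := abs_le_of_sq_le_sq' h1 ha
  rcases lt_or_eq_of_le (show 0 ≤ a + 8 * b by linarith) with h | h
  · exact h
  · exfalso
    apply hne
    refine ⟨?_, h.symm⟩
    have hab : a = -(8 * b) := by linarith
    have : 64 * c ^ 2 = 0 := by nlinarith [hbd, hab]
    exact pow_eq_zero_iff two_ne_zero |>.1 (by linarith : c ^ 2 = 0)

/-- **K1_∂ ⟺ its phase-`(−1)` slice.** The boundary sub-question `TropicalWeilBoundaryVanishing` (K1_∂: at a very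
general tropical Weil eightfold period every CALIBRATED effective tropical `4`-cycle has `W = 0`) is equivalent to
the single-phase statement "every effective tropical `4`-cycle with `W(Z) = −μ(Z)` has `W(Z) = 0`". Reason: the
rational rotation group acts transitively on the rational directions of the boundary circle — a calibrated
counterexample with integer class `(a, b, c)`, `64(b² + c²) = a²`, is transported by the integral `ℤ[i]`-linear map
`diag_ℂ(d, 1, 1, 1)`, `d = −8c + (a + 8b)i` (so that `d·(b − ic) = −(a/8)·conj d`), to an unobstructed seed on
the congruent period `F Q Fᵀ` with phase `W/μ` multiplied by `d/conj d`, i.e. equal to `−1`, realised near there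
at a Weil-generic period (density of generic periods + the any-base seed transport
`exists_weilGeneric_calibrated_of_collinear_unobstructedSeed`). Nothing here decides K1_∂ or K1, and nothing here
bears on HC. [cite: Zharkov2020TropicalWeil, §2 (pp. 2–4)] [cite: MikhalkinZharkov2014Eigenwave, Prop. 4.3 and Thm. 5.4] -/
theorem tropicalWeilBoundaryVanishing_iff_phase :
    Boundary.TropicalWeilBoundaryVanishing ↔
      ∀ Q : Matrix (Fin (2 * 4)) (Fin (2 * 4)) ℝ, Q.PosDef → Q * weilJ 4 = weilJ 4 * Q → IsWeilGeneric 4 Q →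
        ∀ Z : TropicalTorusCycle (2 * 4) 4 Q, weilFunctional Z = -((μ⟦4, Z⟧ : ℝ) : ℂ) → weilFunctional Z = 0 := by
  classical
  constructor
  · intro h Q hQ hJ hgen Z hW
    refine h Q hQ hJ hgen Z ?_
    rw [hW, norm_neg, Complex.norm_real, Real.norm_eq_abs, abs_of_nonneg]
    refine Finset.sum_nonneg fun σ _ => mul_nonneg (mul_nonneg (Nat.cast_nonneg _) ?_) (sq_nonneg _)
    unfold TropicalCell.latticeVolume
    exact (div_pos (Z.cell σ).edgeCoeff_det_pos (by exact_mod_cast Nat.factorial_pos 4)).le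
  · intro hslice Q hQ hJ hgen Z hcal
    by_contra hW
    have hQS : Q.IsSymm := by
      have h := hQ.1
      rw [Matrix.IsHermitian, Matrix.conjTranspose_eq_transpose_of_trivial] at h
      exact h
    -- integer coordinates of the class, on the cone boundary; collinear determinants
    obtain ⟨a, b, c, hq, ha0, hcone⟩ := Integrality.latticePoint_int Q hQ hJ hgen Z
    have hbd : 64 * (((b : ℤ) : ℝ) ^ 2 + ((c : ℤ) : ℝ) ^ 2) = ((a : ℤ) : ℝ) ^ 2 :=
      (Boundary.norm_weilFunctional_eq_mass_iff_boundary Q hQ hJ Z hq).mp hcal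
    have hbdZ : 64 * (b ^ 2 + c ^ 2) = a ^ 2 := by exact_mod_cast hbd
    obtain ⟨ζ, hζ, hcol⟩ := Boundary.exists_collinear_of_boundary Q hQ hJ Z hq hbd
    have hWf := Boundary.weilFunctional_eq_of_repr Q hJ Z hq
    have hμf := Boundary.mass_eq_of_repr Q hJ Z hq
    obtain ⟨h𝒟re, -⟩ := TropicalHodgeBound.det_frame_mul_map_mul_conjTranspose_pos Q hQ
    set 𝒟 : ℂ := (𝐏⟦4⟧ * Q.map ((↑) : ℝ → ℂ) * (𝐏⟦4⟧)ᴴ).det with h𝒟def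
    have h𝒟 : 𝒟 ≠ 0 := fun h0 => by rw [h0, Complex.zero_re] at h𝒟re; exact lt_irrefl _ h𝒟re
    have hE1 := sq_mul_weilFunctional_of_collinear Z ζ hcol
    by_cases hcase : c = 0 ∧ a + 8 * b = 0
    · -- phase already `−1`: `W = 8𝒟(b - ic) = -a𝒟 = -μ`
      obtain ⟨hc0, hab⟩ := hcase
      apply hW
      apply hslice Q hQ hJ hgen Z
      rw [hWf, hμf, hc0]
      have ha : (((a : ℤ) : ℝ) : ℂ) = -8 * (((b : ℤ) : ℝ) : ℂ) := by
        have : a = -8 * b := by omega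
        rw [this]; push_cast; ring
      rw [ha]; push_cast; ring
    · -- the phase-fixing transport
      have hab : 0 < a + 8 * b := add_eight_mul_pos_of_boundary hbdZ ha0 hcase
      have ha_pos : 0 < a := by nlinarith [abs_le_of_sq_le_sq' (show (8 * b) ^ 2 ≤ a ^ 2 by nlinarith [sq_nonneg c]) ha0]
      set α : ℤ := -8 * c with hα
      set β : ℤ := a + 8 * b with hβ
      have hβ0 : β ≠ 0 := hab.ne'
      obtain ⟨V, T, Rf, -, -, hreal⟩ := genericSpread hQ hJ hgen Z
      set Fr : Matrix (Fin (2 * 4)) (Fin (2 * 4)) ℝ := (𝐅⟦α, β⟧).map ((↑) : ℤ → ℝ) with hFr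
      have hFrJ : Fr * weilJ 4 = weilJ 4 * Fr := by rw [hFr]; exact headDiag_comm α β
      obtain ⟨Z₀, hc, hfr, hW₀, hμ₀, hsec₀⟩ := exists_transport_seed hQS hJ Z
        (fun P' hS' hJ' => ⟨V P', T P', Rf P', hreal P' hS' hJ'⟩) (𝐅⟦α, β⟧)
        (headDiag_det_ne_zero α β (Or.inr hβ0)) hFrJ
      have hFrdet : Fr.det ≠ 0 := by
        rw [hFr, ← Int.cast_det]; exact_mod_cast headDiag_det_ne_zero α β (Or.inr hβ0)
      have hFrunit : IsUnit Fr := (Matrix.isUnit_iff_isUnit_det Fr).2 (isUnit_iff_ne_zero.2 hFrdet)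
      have hFtJ : Frᵀ * weilJ 4 = weilJ 4 * Frᵀ := by
        have h := congrArg Matrix.transpose hFrJ
        rw [Matrix.transpose_mul, Matrix.transpose_mul, TropicalWeilSupply.Negative.weilJ_transpose,
          Matrix.neg_mul, Matrix.mul_neg, neg_inj] at h
        exact h.symm
      have hQ₀S : (Fr * Q * Frᵀ).IsSymm := by
        show (Fr * Q * Frᵀ)ᵀ = Fr * Q * Frᵀ
        rw [Matrix.transpose_mul, Matrix.transpose_mul, Matrix.transpose_transpose, hQS.eq, Matrix.mul_assoc]
      have hQ₀J : Fr * Q * Frᵀ * weilJ 4 = weilJ 4 * (Fr * Q * Frᵀ) := by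
        rw [Matrix.mul_assoc, hFtJ, ← Matrix.mul_assoc, Matrix.mul_assoc Fr, hJ, ← Matrix.mul_assoc, hFrJ]
        simp only [Matrix.mul_assoc]
      have hQ₀pd : (Fr * Q * Frᵀ).PosDef := by
        have hinj : Function.Injective Fr.vecMul := Matrix.vecMul_injective_iff_isUnit.2 hFrunit
        have h := Matrix.PosDef.mul_mul_conjTranspose_same hQ hinj
        rwa [Matrix.conjTranspose_eq_transpose_of_trivial] at h
      have hacc : ∀ U : Set (Matrix (Fin (2 * 4)) (Fin (2 * 4)) ℝ), IsOpen U → Fr * Q * Frᵀ ∈ U →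
          ∃ Q' ∈ U, Q'.PosDef ∧ Q' * weilJ 4 = weilJ 4 * Q' ∧ IsWeilGeneric 4 Q' :=
        fun U hU h0 => exists_weilGeneric_mem_of_open_of_posDef _ hQ₀pd hQ₀J U hU h0
      -- `det_ℂ F = d = α + βi ≠ 0`, `W(Z₀) ≠ 0`
      have hd : detC⟦4, 𝐅⟦α, β⟧⟧ = (α : ℂ) + (β : ℂ) * Complex.I := headDiag_detC α β
      set d : ℂ := (α : ℂ) + (β : ℂ) * Complex.I with hddef
      have hd0 : d ≠ 0 := by
        intro h0
        have := congrArg Complex.im h0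
        simp [hddef] at this
        exact hβ0 (by exact_mod_cast this)
      have hW₀ne : weilFunctional Z₀ ≠ 0 := by
        rw [hW₀, hd]
        refine mul_ne_zero (mul_ne_zero ?_ (pow_ne_zero 2 hd0)) hW
        have hdetR : ((𝐅⟦α, β⟧).det : ℝ) ≠ 0 := by exact_mod_cast headDiag_det_ne_zero α β (Or.inr hβ0)
        have h2 : (0 : ℝ) < ((𝐅⟦α, β⟧).det : ℝ) ^ 2 := lt_of_le_of_ne (sq_nonneg _) (Ne.symm (pow_ne_zero 2 hdetR))
        have : (0 : ℝ) < (((𝐅⟦α, β⟧).det : ℝ) ^ 2) ^ 4 := pow_pos h2 4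
        exact_mod_cast this.ne'
      -- collinearity of `Z₀` with `ζ₀ = ζ · conj d`
      have hcol₀ : ∀ σ, (ζ * (starRingEnd ℂ) d * frameComplexDet 4 (Z₀.cell σ).frame).re = 0 := by
        intro σ
        obtain ⟨R, hR, hfac⟩ := hfr σ
        have := collinear_transport (𝐅⟦α, β⟧) hFrJ _ _ R hfac hR ζ (hcol _)
        rwa [hd] at this
      have hζ₀ : ζ * (starRingEnd ℂ) d ≠ 0 := mul_ne_zero hζ ((map_ne_zero (starRingEnd ℂ)).2 hd0)
      -- a Weil-generic realisation with the same collinearity, calibrated, `W ≠ 0`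
      obtain ⟨Q'', hQ''pd, hQ''J, hgen'', Z'', -, hW''ne, hcol'', -⟩ :=
        exists_weilGeneric_calibrated_of_collinear_unobstructedSeed hQ₀S hQ₀J hacc Z₀ hW₀ne
          (ζ * (starRingEnd ℂ) d) hζ₀ hcol₀ hsec₀
      have hE2 := sq_mul_weilFunctional_of_collinear Z'' (ζ * (starRingEnd ℂ) d) hcol''
      -- the phase of `Z''` is `−1`
      set X : ℂ := 8 * ((((b : ℤ) : ℝ) : ℂ) - Complex.I * (((c : ℤ) : ℝ) : ℂ)) with hX
      have hkey : d * X = -(((a : ℤ) : ℝ) : ℂ) * (starRingEnd ℂ) d := by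
        apply Complex.ext
        · simp [hddef, hX, hα, hβ]
          ring
        · simp [hddef, hX, hα, hβ]
          linear_combination hbd
      have hdd : d * (starRingEnd ℂ) d = (((‖d‖ ^ 2 : ℝ)) : ℂ) := by
        rw [Complex.mul_conj, Complex.normSq_eq_norm_sq]
      have hE1' : ζ ^ 2 * X = -((((‖ζ‖ ^ 2 : ℝ)) : ℂ) * (((a : ℤ) : ℝ) : ℂ)) := by
        have h1 : ζ ^ 2 * (𝒟 * X) = -((((‖ζ‖ ^ 2 : ℝ)) : ℂ) * ((((a : ℤ) : ℝ) : ℂ) * 𝒟)) := by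
          have e : 𝒟 * X = weilFunctional Z := by rw [hWf, hX]; ring
          rw [e, hE1, ← hμf]; push_cast; ring
        have h2 : 𝒟 * (ζ ^ 2 * X + (((‖ζ‖ ^ 2 : ℝ)) : ℂ) * (((a : ℤ) : ℝ) : ℂ)) = 0 := by
          linear_combination h1
        have h3 := (mul_eq_zero.1 h2).resolve_left h𝒟
        linear_combination h3
      have hE2' : (ζ * (starRingEnd ℂ) d) ^ 2 * weilFunctional Z'' =
          -((((‖ζ‖ ^ 2 : ℝ)) : ℂ) * (((‖d‖ ^ 2 : ℝ)) : ℂ) * ((μ⟦4, Z''⟧ : ℝ) : ℂ)) := by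
        rw [hE2, norm_mul, Complex.norm_conj, mul_pow]; push_cast; ring
      have hfinal : (((‖ζ‖ ^ 2 : ℝ)) : ℂ) * (((a : ℤ) : ℝ) : ℂ) * ((starRingEnd ℂ) d) ^ 2 *
          (weilFunctional Z'' + ((μ⟦4, Z''⟧ : ℝ) : ℂ)) = 0 := by
        linear_combination (((starRingEnd ℂ) d) ^ 2 * weilFunctional Z'') * hE1' + (-X) * hE2' +
          ((((‖ζ‖ ^ 2 : ℝ)) : ℂ) * ((μ⟦4, Z''⟧ : ℝ) : ℂ) * (starRingEnd ℂ) d) * hkey +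
          (-(X * (((‖ζ‖ ^ 2 : ℝ)) : ℂ) * ((μ⟦4, Z''⟧ : ℝ) : ℂ))) * hdd
      have hnz : (((‖ζ‖ ^ 2 : ℝ)) : ℂ) ≠ 0 := by
        have : (0 : ℝ) < ‖ζ‖ ^ 2 := by positivity
        exact_mod_cast this.ne'
      have haC : (((a : ℤ) : ℝ) : ℂ) ≠ 0 := by exact_mod_cast ha_pos.ne'
      have hcd : ((starRingEnd ℂ) d) ^ 2 ≠ 0 := pow_ne_zero 2 ((map_ne_zero (starRingEnd ℂ)).2 hd0)
      have hsum : weilFunctional Z'' + ((μ⟦4, Z''⟧ : ℝ) : ℂ) = 0 := by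
        rcases mul_eq_zero.1 hfinal with h | h
        · rcases mul_eq_zero.1 h with h' | h'
          · rcases mul_eq_zero.1 h' with h'' | h''
            · exact absurd h'' hnz
            · exact absurd h'' haC
          · exact absurd h' hcd
        · exact h
      have hW''eq : weilFunctional Z'' = -((μ⟦4, Z''⟧ : ℝ) : ℂ) := by linear_combination hsum
      exact hW''ne (hslice Q'' hQ''pd hQ''J hgen'' Z'' hW''eq)

/-- **K1_∂ ⟺ "purely imaginary determinants never close up".** Equivalently: at a very general tropical Weil
eightfold period, every effective tropical `4`-cycle ALL OF WHOSE CELLS HAVE PURELY IMAGINARY COMPLEX DETERMINANT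
(`Re η_σ = 0`, `η_σ = det_ℂ` of the frame in the coordinates `z_k = x_k + i x_{k+4}`) is EMPTY — the verbatim
`n = 4` analogue of the property `CalibTwo.reEta_Fz_eq_zero` that the tree's unobstructed `n = 2` seed HAS
(`…CalibrationTwoBoundary`, p358045: at n = 2 such cycles exist at very general periods). Nothing here decides
K1_∂; it removes the phase from the statement. [cite: Zharkov2020TropicalWeil, §2 (pp. 2–4)] -/
theorem tropicalWeilBoundaryVanishing_iff_re_eq_zero :
    Boundary.TropicalWeilBoundaryVanishing ↔
      ∀ Q : Matrix (Fin (2 * 4)) (Fin (2 * 4)) ℝ, Q.PosDef → Q * weilJ 4 = weilJ 4 * Q → IsWeilGeneric 4 Q →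
        ∀ Z : TropicalTorusCycle (2 * 4) 4 Q, (∀ σ, (frameComplexDet 4 (Z.cell σ).frame).re = 0) → Z.numCells = 0 := by
  rw [tropicalWeilBoundaryVanishing_iff_phase]
  constructor
  · intro h Q hQ hJ hgen Z hre
    have hW := weilFunctional_eq_neg_mass_of_re_eq_zero Z hre
    have hW0 := h Q hQ hJ hgen Z hW
    have hcal : ‖weilFunctional Z‖ = μ⟦4, Z⟧ := by
      rw [hW, norm_neg, Complex.norm_real, Real.norm_eq_abs, abs_of_nonneg]
      refine Finset.sum_nonneg fun σ _ => mul_nonneg (mul_nonneg (Nat.cast_nonneg _) ?_) (sq_nonneg _)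
      unfold TropicalCell.latticeVolume
      exact (div_pos (Z.cell σ).edgeCoeff_det_pos (by exact_mod_cast Nat.factorial_pos 4)).le
    exact Boundary.numCells_eq_zero_of_calibrated_of_weilFunctional_eq_zero Q hQ hJ hgen Z hcal hW0
  · intro h Q hQ hJ hgen Z hW
    exact Boundary.weilFunctional_eq_zero_of_numCells_eq_zero Z
      (h Q hQ hJ hgen Z (re_eq_zero_of_weilFunctional_eq_neg_mass Z hW))

end Summit.HodgeConjecture.HodgeConjecture.Theorems.TropicalWeilVanishing.Phases

end
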